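import Summits.ResolutionOfSingularities.ResolutionOfSingularities.Theorems.FrobeniusClosingSteerInsepStepChart
import Summits.ResolutionOfSingularities.ResolutionOfSingularities.Theorems.FrobeniusClosingSteerMemberDerivations
import Literature.AlgebraicGeometry.Resolution.RegularLocalRingsNormal
import Mathlib.Algebra.MvPolynomial.PDeriv
import HarnessLib

/-!
# Steer / LEMMA I kernel, file F4: THE READINGS — the form `F` with `F(X, Y, Z) = f`, the weak transform `F₁ = F(1, t, z')`, the chain rule for a
# derivation of the new member, and the univariate polynomial `θ G = G(1, T, 0)` that is read in `R̄ = S₁ ⧸ (X, z')`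

OURS (campaign res-hironaka, rung L ★L-G4, slot W4.1, crux `Steer` stmt-ResolutionOfSingularities-16345; res-L0-w41-plan-1 RULING 155a, kernel of
res-L0-w41-idea-3's LEMMA I `InsepStepNotIsolated`; res-L0-w41-stub-3 g7, blueprint `KERNEL-BLUEPRINT-LemmaI.md` 693d33707585fe97 §4; replaces the role
of no printed item; NOT a statement of the manuscript under review [claim: Hironaka2017, status: under-review]; AI review is weaker than expert review).
Theses-free, definition-free. Pure (multivariate) polynomial algebra:

* `exists_form_eval_eq` — `f ∈ 𝔪₀^d`, `𝔪₀ = (X, Y, Z)` ⇒ `f = F(X, Y, Z)` for a form `F` of degree `d` over `S₀` (tree `exists_isHomogeneous_eval_eq_of_mem_pow`);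
* `eval₂_smul_of_isHomogeneous`, `eq_eval₂_chart` — `F(X, Y, Z) = X^d · F(1, t, z')` in `S₁` (`t X = Y`, `z' X = Z`), so the weak transform `F₁` (with
  `F₁ X^d = f`) IS `F(1, t, z')`;
* `map_derivCoeff`, `derivation_eval₂_chart` — the chain rule `D F(1,t,z') = (∂₁F)(1,t,z')·D t + (∂₂F)(1,t,z')·D z' + F^δ(1,t,z')` for a derivation `D` of `S₁`
  extending `δ ∈ Der(S₀)` (tree `MemberDerivations.derivation_eval`), `F^δ` = `δ` on the coefficients;
* `eval₂_sub_eval₂_mem_span` — `G(1, t, z') ≡ G(1, t, 0) mod (z')`; `eval₂_theta` — `G(1, t, 0) = (θ G)(t)` with `θ G := G(1, T, 0) ∈ S₀[T]`;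
* `coeff_theta`, `degree_theta_le` — for a FORM `G` of degree `n`: `(θ G).coeff j = G.coeff (n − j, j, 0)` and `deg θ G ≤ n`;
* `isHomogeneous_pderiv_of`, `coeff_theta_pderiv_two`, `coeff_theta_pderiv_one`, `coeff_theta_derivCoeff` — `∂₂F`, `∂₁F`, `F^δ` are forms; their
  `θ`-coefficients are the `Z`-linear layer `c_(d−1−j, j, 1)`, `(j+1)·c_(d−1−j, j+1, 0)` and `δ c_(d−j, j, 0)` of `F`;
* `mvPolynomial_eval₂_mem_map_of_forall_coeff_mem` — a polynomial with coefficients in `J` evaluates into `J S₁`;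
* `eval₂_sub_eval₂_mem_sq` — if the `Z`-linear layer of `F` has coefficients in `𝔪₀` then `F(1, t, z') ≡ F(1, t, 0) mod (X, z')²`.
[cite: Matsumura1987, Thm. 17.10] [folklore]
-/

noncomputable section

-- single-problem summit: the doubled namespace component `ResolutionOfSingularities` is forced
set_option linter.dupNamespace false

namespace Summit.ResolutionOfSingularities.ResolutionOfSingularities.Theorems.SwitchingDichotomy.LemmaI

open IsLocalRing MvPolynomial Literature.AlgebraicGeometry.Resolution
open Summit.ResolutionOfSingularities.ResolutionOfSingularities.Theorems.SwitchingDichotomy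

/-! ## §1 The form `F` and the weak transform -/

section Form

variable {L : Type} [Field L] {S₀ S₁ : Subring L}

/-- `range ![X, Y, Z] = {X, Y, Z}` (re-proved inline to stay import-light). [folklore] -/
theorem span_range_vec3 {R : Type*} [CommRing R] (X Y Z : R) : Ideal.span (Set.range ![X, Y, Z]) = Ideal.span {X, Y, Z} := by
  rw [Matrix.range_cons, Matrix.range_cons_cons_empty, Set.singleton_union]

/-- **`f ∈ 𝔪₀^d` is a form of degree `d` in the parameters**: `f = F(X, Y, Z)`, `F ∈ S₀[X₀, X₁, X₂]` homogeneous of degree `d`.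
[cite: Matsumura1987, Thm. 17.10] -/
theorem exists_form_eval_eq [IsLocalRing S₀] {X Y Z : S₀} (hXYZ : Ideal.span {X, Y, Z} = maximalIdeal S₀) {d : ℕ} {f : S₀}
    (hf : f ∈ maximalIdeal S₀ ^ d) : ∃ F : MvPolynomial (Fin 3) S₀, F.IsHomogeneous d ∧ eval ![X, Y, Z] F = f :=
  exists_isHomogeneous_eval_eq_of_mem_pow ![X, Y, Z] (by rw [span_range_vec3]; exact hXYZ) hf

/-- The degree of a monomial in the support of a form. [folklore] -/
theorem degree_eq_of_coeff_ne_zero {R : Type*} [CommSemiring R] {σ : Type*} {G : MvPolynomial σ R} {n : ℕ} (hG : G.IsHomogeneous n)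
    {m : σ →₀ ℕ} (hm : G.coeff m ≠ 0) : m.degree = n := by
  by_contra hne
  exact hm (hG.coeff_eq_zero hne)

/-- **Forms scale**: `G(c·w) = c^n · G(w)` for a form `G` of degree `n` (evaluation through any ring map). [folklore] -/
theorem eval₂_smul_of_isHomogeneous {R A : Type*} [CommSemiring R] [CommSemiring A] (φ : R →+* A) {G : MvPolynomial (Fin 3) R} {n : ℕ}
    (hG : G.IsHomogeneous n) (c : A) (w : Fin 3 → A) :
    eval₂ φ (fun i => c * w i) G = c ^ n * eval₂ φ w G := by
  rw [eval₂_eq', eval₂_eq', Finset.mul_sum]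
  refine Finset.sum_congr rfl fun m hm => ?_
  have hdeg : m.degree = n := degree_eq_of_coeff_ne_zero hG (mem_support_iff.mp hm)
  have hprod : (∏ i, (c * w i) ^ m i) = c ^ n * ∏ i, w i ^ m i := by
    simp_rw [mul_pow]
    rw [Finset.prod_mul_distrib, Finset.prod_pow_eq_pow_sum, ← Finsupp.degree_eq_sum, hdeg]
  rw [hprod]
  ring

/-- **The weak transform is `F(1, t, z')`.** If `t·X = Y`, `z'·X = Z` in `S₁` (`X ≠ 0`) and `F₁ · X^d = F(X, Y, Z)` for a form `F` of degree `d`, then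
`F₁ = F(1, t, z')`. [folklore] -/
theorem eq_eval₂_chart (h : S₀ ≤ S₁) {X Y Z : S₀} (hX0 : (X : L) ≠ 0) (t₁ z₁ : S₁)
    (ht : t₁ * Subring.inclusion h X = Subring.inclusion h Y) (hz : z₁ * Subring.inclusion h X = Subring.inclusion h Z)
    {d : ℕ} {F : MvPolynomial (Fin 3) S₀} (hF : F.IsHomogeneous d) {F₁ : S₁}
    (hF₁ : F₁ * Subring.inclusion h X ^ d = Subring.inclusion h (eval ![X, Y, Z] F)) :
    F₁ = eval₂ (Subring.inclusion h) ![1, t₁, z₁] F := by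
  set ι := Subring.inclusion h
  have hX0' : X ≠ 0 := fun e => hX0 (by simp [e])
  have hX1 : (ι X : S₁) ≠ 0 := (map_ne_zero_iff ι (Subring.inclusion_injective h)).mpr hX0'
  have hfun : (ι ∘ ![X, Y, Z] : Fin 3 → S₁) = fun i => ι X * ![1, t₁, z₁] i := by
    funext i
    fin_cases i
    · simp
    · simpa using (by rw [mul_comm]; exact ht.symm : ι Y = ι X * t₁)
    · simpa using (by rw [mul_comm]; exact hz.symm : ι Z = ι X * z₁)
  have hcomp : ι (eval ![X, Y, Z] F) = eval₂ ι (fun i => ι X * ![1, t₁, z₁] i) F := by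
    rw [← hfun]
    have := eval₂_comp_left ι (RingHom.id S₀) ![X, Y, Z] F
    rw [RingHom.comp_id] at this
    rw [← this]
    rfl
  rw [hcomp, eval₂_smul_of_isHomogeneous ι hF, mul_comm] at hF₁
  exact mul_left_cancel₀ (pow_ne_zero d hX1) hF₁.symm |>.symm

end Form

/-! ## §2 The chain rule in the chart -/

section ChainRule

variable {L : Type} [Field L] {S₀ S₁ : Subring L}

/-- **Coefficientwise derivative commutes with extension**: for `D ∈ Der(S₁)` extending `δ ∈ Der(S₀)` along `ι`, `(ι F)^D = ι (F^δ)`. [folklore] -/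
theorem map_derivCoeff (h : S₀ ≤ S₁) (δ : Derivation ℤ S₀ S₀) (D : Derivation ℤ S₁ S₁)
    (hD : ∀ a : S₀, D (Subring.inclusion h a) = Subring.inclusion h (δ a)) {n : ℕ} (F : MvPolynomial (Fin n) S₀) :
    (∑ m ∈ (map (Subring.inclusion h) F).support, monomial m (D (coeff m (map (Subring.inclusion h) F)))) =
      map (Subring.inclusion h) (∑ m ∈ F.support, monomial m (δ (coeff m F))) := by
  ext m
  rw [MemberDerivations.coeff_sum_monomial_derivation, coeff_map, coeff_map, MemberDerivations.coeff_sum_monomial_derivation, hD]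

/-- **Chain rule in the chart.** For `D ∈ Der(S₁)` extending `δ ∈ Der(S₀)` and `w = (1, t, z')`:
`D F(w) = (∂₁F)(w)·D t + (∂₂F)(w)·D z' + F^δ(w)` (evaluations through `ι : S₀ → S₁`; `D 1 = 0`). [folklore] -/
theorem derivation_eval₂_chart (h : S₀ ≤ S₁) (δ : Derivation ℤ S₀ S₀) (D : Derivation ℤ S₁ S₁)
    (hD : ∀ a : S₀, D (Subring.inclusion h a) = Subring.inclusion h (δ a)) (t₁ z₁ : S₁) (F : MvPolynomial (Fin 3) S₀) :
    D (eval₂ (Subring.inclusion h) ![1, t₁, z₁] F) =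
      eval₂ (Subring.inclusion h) ![1, t₁, z₁] (pderiv 1 F) * D t₁ + eval₂ (Subring.inclusion h) ![1, t₁, z₁] (pderiv 2 F) * D z₁ +
        eval₂ (Subring.inclusion h) ![1, t₁, z₁] (∑ m ∈ F.support, monomial m (δ (coeff m F))) := by
  set ι := Subring.inclusion h
  set w : Fin 3 → S₁ := ![1, t₁, z₁]
  have key := MemberDerivations.derivation_eval D w (map ι F)
  rw [eval_map, map_derivCoeff h δ D hD, eval_map] at key
  simp only [pderiv_map, eval_map] at key
  rw [key, Fin.sum_univ_three]
  have h0 : D (w 0) = 0 := by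
    change D 1 = 0
    exact D.map_one_eq_zero
  rw [h0, mul_zero, zero_add]
  rfl

end ChainRule

/-! ## §3 Reading modulo `(z')`: the univariate polynomial `θ G = G(1, T, 0)` -/

section Theta

variable {L : Type} [Field L] {S₀ S₁ : Subring L}

/-- `G(1, t, z') ≡ G(1, t, 0) mod (z')`. [folklore] -/
theorem eval₂_sub_eval₂_mem_span (h : S₀ ≤ S₁) (t₁ z₁ : S₁) (G : MvPolynomial (Fin 3) S₀) :
    eval₂ (Subring.inclusion h) ![1, t₁, z₁] G - eval₂ (Subring.inclusion h) ![1, t₁, 0] G ∈ Ideal.span {z₁} := by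
  set ι := Subring.inclusion h
  rw [← Ideal.Quotient.eq, ← coe_eval₂Hom, ← coe_eval₂Hom, ← RingHom.comp_apply, ← RingHom.comp_apply]
  congr 1
  refine ringHom_ext (fun c => by simp) (fun i => ?_)
  fin_cases i
  · simp
  · simp
  · simp only [RingHom.comp_apply, coe_eval₂Hom, eval₂_X]
    change Ideal.Quotient.mk (Ideal.span {z₁}) z₁ = Ideal.Quotient.mk (Ideal.span {z₁}) 0
    rw [map_zero, Ideal.Quotient.eq_zero_iff_mem]
    exact Ideal.mem_span_singleton_self z₁

/-- **`G(1, t, 0) = (θ G)(t)`** for `θ G := G(1, T, 0) ∈ S₀[T]`. [folklore] -/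
theorem eval₂_theta (h : S₀ ≤ S₁) (t₁ : S₁) (G : MvPolynomial (Fin 3) S₀) :
    Polynomial.eval₂ (Subring.inclusion h) t₁ (eval₂ Polynomial.C ![1, Polynomial.X, 0] G) =
      eval₂ (Subring.inclusion h) ![1, t₁, 0] G := by
  set ι := Subring.inclusion h
  rw [← coe_eval₂Hom, ← coe_eval₂Hom, ← Polynomial.coe_eval₂RingHom, ← RingHom.comp_apply]
  congr 1
  refine ringHom_ext (fun c => by simp) (fun i => ?_)
  fin_cases i <;> simp

/-- The exponent `(n − j, j, 0)`. Values and degree. [folklore] -/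
theorem layer_apply (n j : ℕ) :
    (Finsupp.single (0 : Fin 3) (n - j) + Finsupp.single (1 : Fin 3) j : Fin 3 →₀ ℕ) (0 : Fin 3) = n - j ∧
    (Finsupp.single (0 : Fin 3) (n - j) + Finsupp.single (1 : Fin 3) j : Fin 3 →₀ ℕ) (1 : Fin 3) = j ∧
    (Finsupp.single (0 : Fin 3) (n - j) + Finsupp.single (1 : Fin 3) j : Fin 3 →₀ ℕ) (2 : Fin 3) = 0 := by
  refine ⟨?_, ?_, ?_⟩ <;> simp

/-- A monomial exponent on `Fin 3` with prescribed values. [folklore] -/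
theorem eq_layer_of_apply {m : Fin 3 →₀ ℕ} {n j : ℕ} (h0 : m 0 = n - j) (h1 : m 1 = j) (h2 : m 2 = 0) :
    m = Finsupp.single (0 : Fin 3) (n - j) + Finsupp.single 1 j := by
  obtain ⟨e0, e1, e2⟩ := layer_apply n j
  ext i
  fin_cases i
  · exact h0.trans e0.symm
  · exact h1.trans e1.symm
  · exact h2.trans e2.symm

/-- **Coefficients of `θ G` for a form `G` of degree `n`**: `(θ G).coeff j = G.coeff (n − j, j, 0)`. [folklore] -/
theorem coeff_theta {R : Type*} [CommRing R] {G : MvPolynomial (Fin 3) R} {n : ℕ} (hG : G.IsHomogeneous n) (j : ℕ) :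
    (eval₂ Polynomial.C ![1, Polynomial.X, 0] G).coeff j = G.coeff (Finsupp.single (0 : Fin 3) (n - j) + Finsupp.single 1 j) := by
  classical
  obtain ⟨e0, e1, e2⟩ := layer_apply n j
  set e : Fin 3 →₀ ℕ := Finsupp.single (0 : Fin 3) (n - j) + Finsupp.single 1 j with he
  rw [eval₂_eq', Polynomial.finsetSum_coeff]
  have hterm : ∀ m : Fin 3 →₀ ℕ, (Polynomial.C (G.coeff m) * ∏ i, (![1, Polynomial.X, 0] : Fin 3 → Polynomial R) i ^ m i).coeff j =
      if m 2 = 0 ∧ m 1 = j then G.coeff m else 0 := by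
    intro m
    rw [Fin.prod_univ_three]
    simp only [Matrix.cons_val_zero, Matrix.cons_val_one, Matrix.cons_val, one_pow, one_mul]
    by_cases h2 : m 2 = 0
    · rw [h2, pow_zero, mul_one, Polynomial.coeff_C_mul, Polynomial.coeff_X_pow]
      by_cases h1 : m 1 = j
      · simp [h1]
      · have h1' : ¬ j = m 1 := fun e => h1 e.symm
        simp [h1, h1']
    · rw [zero_pow h2, mul_zero, mul_zero, Polynomial.coeff_zero]
      simp [h2]
  simp_rw [hterm]
  rw [Finset.sum_eq_single e]
  · simp [e1, e2]
  · intro m hm hme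
    rw [if_neg]
    rintro ⟨h2, h1⟩
    apply hme
    have hdeg : m.degree = n := degree_eq_of_coeff_ne_zero hG (mem_support_iff.mp hm)
    rw [Finsupp.degree_eq_sum, Fin.sum_univ_three, h1, h2, add_zero] at hdeg
    exact eq_layer_of_apply (by omega) h1 h2
  · intro hne
    rw [notMem_support_iff.mp hne]
    simp

/-- **`deg θ G ≤ n`** for a form `G` of degree `n`. [folklore] -/
theorem degree_theta_le {R : Type*} [CommRing R] {G : MvPolynomial (Fin 3) R} {n : ℕ} (hG : G.IsHomogeneous n) :
    (eval₂ Polynomial.C ![1, Polynomial.X, 0] G).degree ≤ n := by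
  rw [Polynomial.degree_le_iff_coeff_zero]
  intro j hj
  have hj' : n < j := by exact_mod_cast hj
  rw [coeff_theta hG]
  refine hG.coeff_eq_zero ?_
  rw [map_add, Finsupp.degree_single, Finsupp.degree_single]
  omega

/-- `deg θ G < 2N` whenever `G` is a form of degree `n < 2N`. [folklore] -/
theorem degree_theta_lt {R : Type*} [CommRing R] {G : MvPolynomial (Fin 3) R} {n : ℕ} (hG : G.IsHomogeneous n) {N : ℕ}
    (hn : n < 2 * N) : (eval₂ Polynomial.C ![1, Polynomial.X, 0] G).degree < (2 * N : ℕ) :=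
  (degree_theta_le hG).trans_lt (by exact_mod_cast hn)

end Theta

/-! ## §4 Layers: derivatives of the form, coefficients in an ideal, and `F(1,t,z') ≡ F(1,t,0) mod (X, z')²` -/

section Layers

variable {L : Type} [Field L] {S₀ S₁ : Subring L}

/-- Partial derivatives of a form of degree `n + 1` are forms of degree `n`. [folklore] -/
theorem isHomogeneous_pderiv_of {R : Type*} [CommRing R] {σ : Type*} {G : MvPolynomial σ R} {n : ℕ}
    (hG : G.IsHomogeneous (n + 1)) (i : σ) : (pderiv i G).IsHomogeneous n := by
  classical
  intro m hm
  rw [coeff_pderiv] at hm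
  have hc : G.coeff (m + Finsupp.single i 1) ≠ 0 := left_ne_zero_of_mul hm
  have hdeg : (m + Finsupp.single i 1).degree = n + 1 := degree_eq_of_coeff_ne_zero hG hc
  rw [map_add, Finsupp.degree_single] at hdeg
  have : m.degree = n := by omega
  rw [Finsupp.degree_eq_weight_one] at this
  exact this

/-- The coefficientwise derivative of a form is a form of the same degree (tree). [folklore] -/
theorem isHomogeneous_derivCoeff {R : Type*} [CommRing R] {d : ℕ} (δ : Derivation ℤ R R) {G : MvPolynomial (Fin d) R} {n : ℕ}
    (hG : G.IsHomogeneous n) : (∑ m ∈ G.support, monomial m (δ (coeff m G))).IsHomogeneous n :=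
  MemberDerivations.isHomogeneous_sum_monomial_derivation δ hG

/-- **The `Z`-linear layer**: `(θ ∂₂F).coeff j = F.coeff (d − 1 − j, j, 1)` for a form `F` of degree `d = n + 1`. [folklore] -/
theorem coeff_theta_pderiv_two {R : Type*} [CommRing R] {F : MvPolynomial (Fin 3) R} {n : ℕ} (hF : F.IsHomogeneous (n + 1)) (j : ℕ) :
    (eval₂ Polynomial.C ![1, Polynomial.X, 0] (pderiv 2 F)).coeff j =
      F.coeff (Finsupp.single (0 : Fin 3) (n - j) + Finsupp.single 1 j + Finsupp.single 2 1) := by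
  obtain ⟨-, -, e2⟩ := layer_apply n j
  rw [coeff_theta (isHomogeneous_pderiv_of hF 2), coeff_pderiv, e2]
  simp

/-- **The `Y`-derivative layer**: `(θ ∂₁F).coeff j = (j + 1) · F.coeff (d − 1 − j, j + 1, 0)` for a form `F` of degree `d = n + 1`. [folklore] -/
theorem coeff_theta_pderiv_one {R : Type*} [CommRing R] {F : MvPolynomial (Fin 3) R} {n : ℕ} (hF : F.IsHomogeneous (n + 1)) (j : ℕ) :
    (eval₂ Polynomial.C ![1, Polynomial.X, 0] (pderiv 1 F)).coeff j =
      F.coeff (Finsupp.single (0 : Fin 3) (n - j) + Finsupp.single 1 j + Finsupp.single 1 1) * (j + 1) := by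
  obtain ⟨-, e1, -⟩ := layer_apply n j
  rw [coeff_theta (isHomogeneous_pderiv_of hF 1), coeff_pderiv, e1]

/-- **The coefficientwise-derivative layer**: `(θ F^δ).coeff j = δ (F.coeff (n − j, j, 0))`. [folklore] -/
theorem coeff_theta_derivCoeff {R : Type*} [CommRing R] (δ : Derivation ℤ R R) {F : MvPolynomial (Fin 3) R} {n : ℕ}
    (hF : F.IsHomogeneous n) (j : ℕ) :
    (eval₂ Polynomial.C ![1, Polynomial.X, 0] (∑ m ∈ F.support, monomial m (δ (coeff m F)))).coeff j =
      δ (F.coeff (Finsupp.single (0 : Fin 3) (n - j) + Finsupp.single 1 j)) := by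
  rw [coeff_theta (isHomogeneous_derivCoeff δ hF), MemberDerivations.coeff_sum_monomial_derivation]

/-- **A polynomial with coefficients in an ideal `J` evaluates into the extension of `J`.** [folklore] -/
theorem mvPolynomial_eval₂_mem_map_of_forall_coeff_mem {R A : Type*} [CommRing R] [CommRing A] (φ : R →+* A) {σ : Type*} [Fintype σ]
    (w : σ → A) {J : Ideal R} {G : MvPolynomial σ R} (hG : ∀ m, G.coeff m ∈ J) : eval₂ φ w G ∈ J.map φ := by
  rw [eval₂_eq']
  exact Submodule.sum_mem _ fun m _ => Ideal.mul_mem_right _ _ (Ideal.mem_map_of_mem φ (hG m))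

/-- **`F(1, t, z') ≡ F(1, t, 0) mod (X, z')²`** when the `Z`-linear layer of the form `F` (degree `n + 1`) has coefficients in `𝔪₀` and `𝔪₀ S₁ ⊆ (X)`:
termwise, `c_e t^{e₁} z'^{e₂} − c_e t^{e₁} 0^{e₂}` is `0` (`e₂ = 0`), lies in `X·z' S₁` (`e₂ = 1`), or in `z'² S₁` (`e₂ ≥ 2`). [folklore] -/
theorem eval₂_sub_eval₂_mem_sq [IsLocalRing S₀] (h : S₀ ≤ S₁) {X : S₀} (hB : blowupRing S₀ (X : L) ≤ S₁) (hX0 : (X : L) ≠ 0)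
    (t₁ z₁ : S₁) {F : MvPolynomial (Fin 3) S₀}
    (hlayer : ∀ m : Fin 3 →₀ ℕ, m 2 = 1 → F.coeff m ∈ maximalIdeal S₀) :
    eval₂ (Subring.inclusion h) ![1, t₁, z₁] F - eval₂ (Subring.inclusion h) ![1, t₁, 0] F ∈
      Ideal.span {Subring.inclusion h X, z₁} ^ 2 := by
  set ι := Subring.inclusion h
  set I : Ideal S₁ := Ideal.span {ι X, z₁} with hI
  have hXI : ι X ∈ I := Ideal.subset_span (by simp)
  have hzI : z₁ ∈ I := Ideal.subset_span (by simp)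
  rw [eval₂_eq', eval₂_eq', ← Finset.sum_sub_distrib]
  refine Submodule.sum_mem _ fun m _ => ?_
  have hdiff : ι (F.coeff m) * ∏ i, (![1, t₁, z₁] : Fin 3 → S₁) i ^ m i -
      ι (F.coeff m) * ∏ i, (![1, t₁, 0] : Fin 3 → S₁) i ^ m i = ι (F.coeff m) * t₁ ^ m 1 * (z₁ ^ m 2 - 0 ^ m 2) := by
    rw [Fin.prod_univ_three, Fin.prod_univ_three]
    simp only [Matrix.cons_val_zero, Matrix.cons_val_one, Matrix.cons_val, one_pow, one_mul]
    ring
  rw [hdiff]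
  rcases Nat.lt_or_ge (m 2) 2 with hlt | hge
  · interval_cases h2 : m 2
    · simp
    · -- the `Z`-linear layer: coefficient in `𝔪₀ ⊆ X S₁`
      rw [pow_one, pow_one, sub_zero]
      have hc : ι (F.coeff m) ∈ Ideal.span {ι X} := inclusion_mem_span_exc h hB hX0 (hlayer m h2)
      obtain ⟨r, hr⟩ := Ideal.mem_span_singleton'.mp hc
      rw [← hr, pow_two]
      have : r * ι X * t₁ ^ m 1 * z₁ = (r * t₁ ^ m 1) * (ι X * z₁) := by ring
      rw [this]
      exact Ideal.mul_mem_left _ _ (Ideal.mul_mem_mul hXI hzI)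
  · obtain ⟨k, hk⟩ := Nat.exists_eq_add_of_le hge
    rw [hk, zero_pow (by omega), sub_zero, pow_add]
    have : ι (coeff m F) * t₁ ^ m 1 * (z₁ ^ 2 * z₁ ^ k) = (ι (coeff m F) * t₁ ^ m 1 * z₁ ^ k) * (z₁ * z₁) := by ring
    rw [this, pow_two]
    exact Ideal.mul_mem_left _ _ (Ideal.mul_mem_mul hzI hzI)

end Layers

end Summit.ResolutionOfSingularities.ResolutionOfSingularities.Theorems.SwitchingDichotomy.LemmaI

end
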